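import Summits.NavierStokesRegularity.NavierStokesRegularity.Theorems.ExtremiserTransienceNearExtremalTransiencePerFlowOfSparseEfficientTimes
import HarnessLib

/-!
# Route `ExtremiserTransience`, crux `NearExtremalTransiencePerFlow` (stmt-NavierStokesRegularity-26567):
# the crux from the PER-FLOW CROWD REFUTATION alone (the `¬S-E` branch typed as the critic asked)

`--supports stmt-NavierStokesRegularity-26567` (helper).  Author: prover seat `ns-net-p1` (g2), answering idea-crit-4's typing remark on the
α ⊕ δ join (2026-08-28T21:46:07Z: «ask δ hands for the per-flow crowd refutation — stronger, local in the flow — and keep `crux_of_branches` as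
the docking theorem») and LINE g8-α card rev 3.

With LINE g8-α's sparse branch now LANDED end-to-end (`SparseBangBang.nearExtremalTransiencePerFlow_of_sparseEfficientTimes :
SparseEfficientTimes → NearExtremalTransiencePerFlow`, seat ns-net-p2 p674582, over S-B p674582 and S-T p670994), the crux 26567 follows from
the refutation of the complementary CROWD branch alone.  Two typings, both proved here by classical logic:
* `nearExtremalTransiencePerFlow_of_not_sparseEfficientTimes_imp : (¬ SparseEfficientTimes → NearExtremalTransiencePerFlow) → NearExtremalTransiencePerFlow`
  (the docking form `crux_of_branches` with the sparse branch discharged);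
* `nearExtremalTransiencePerFlow_of_perFlowCrowdRefutation` — the PER-FLOW form: if every violator flow that is «crowd-type» (for all `N₀, Θ`
  there is a deficit `ε > 0` and an onset past which NO late time is simultaneously `N₀`-sparse, `Θ`-two-sided-locked and `(κ⋆−ε)`-efficient at
  some height) is contradictory, then the crux holds.  This is exactly the deliverable expected from LINE g7-δ (`member_selection`, T1/T3) /
  item 27695 on the crowd branch.
HONEST FRAMING: classical-logic glue over landed theorems; the crowd refutation is OPEN (it is the complement of the open heart S-E); nothing
about Navier–Stokes regularity or blow-up is proved; no summit is proved by a line. [folklore]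
-/

noncomputable section

open scoped Topology InnerProductSpace RealInnerProductSpace ENNReal ContDiff
open MeasureTheory Filter Set Metric
open Literature.Analysis.FluidPDE
open Summit.NavierStokesRegularity.NavierStokesRegularity.Theses.ExtremiserTransience
open Summit.NavierStokesRegularity.NavierStokesRegularity.Theorems.DepletionLadder.KStar
open Summit.NavierStokesRegularity.NavierStokesRegularity.Theorems.DepletionLadder.KStar.HalfSpace
open Summit.NavierStokesRegularity.NavierStokesRegularity.Theorems.DepletionLadder.KStar.BangBang
open Summit.NavierStokesRegularity.NavierStokesRegularity.Theorems.NearExtremalTransiencePerFlow.ZoneTransversality (PFC IsViolator)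

namespace Summit.NavierStokesRegularity.NavierStokesRegularity.Theorems.NearExtremalTransiencePerFlow.SparseBangBang

-- the problem directory repeats the summit name (`NavierStokesRegularity/NavierStokesRegularity`)
set_option linter.dupNamespace false

/-- **Docking form with the sparse branch discharged**: the crux 26567 follows from any proof of the crux on the `¬ SparseEfficientTimes`
branch (classical case split; the sparse branch is the landed `nearExtremalTransiencePerFlow_of_sparseEfficientTimes`). [folklore] -/
theorem nearExtremalTransiencePerFlow_of_not_sparseEfficientTimes_imp
    (h : ¬ SparseEfficientTimes → NearExtremalTransiencePerFlow) : NearExtremalTransiencePerFlow := by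
  by_cases hE : SparseEfficientTimes
  · exact nearExtremalTransiencePerFlow_of_sparseEfficientTimes hE
  · exact h hE

/-- **The crux 26567 from the PER-FLOW CROWD REFUTATION** (the `¬S-E` branch in its natural, flow-local form): if no violator flow can be
«crowd-type» — i.e. for every violator flow it is contradictory that for all `N₀, Θ` there are a deficit `ε > 0` and an onset `t₁` past which
no late time `t` is simultaneously `N₀`-sparse (`Z(t)√(T−t) ≤ N₀ν^{3/2}`), `Θ`-two-sided-locked and `(κ⋆−ε)`-efficient at some height bound —
then `NearExtremalTransiencePerFlow` holds (the sparse branch being landed). [folklore] -/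
theorem nearExtremalTransiencePerFlow_of_perFlowCrowdRefutation
    (h : ∀ (C ν T : ℝ) (u : ℝ → E3 → E3) (p : ℝ → E3 → ℝ), IsViolator C ν T u p →
      (∀ N₀ Θ : ℝ, ∃ ε : ℝ, 0 < ε ∧ ∃ t₁ ∈ Set.Ico 0 T, ∀ t ∈ Set.Ico t₁ T,
        ¬ (Zen (u t) * Real.sqrt (T - t) ≤ N₀ * (ν * Real.sqrt ν) ∧
           Θ⁻¹ * (ν * (T - t)) * Wpa (u t) ≤ Zen (u t) ∧ Zen (u t) ≤ Θ * (ν * (T - t)) * Wpa (u t) ∧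
           ∃ M : ℝ, (∀ x, ‖u t x‖ ≤ M) ∧ 0 < M * Real.sqrt (Zen (u t)) * Real.sqrt (Wpa (u t)) ∧
             (kStar - ε) * M * Real.sqrt (Zen (u t)) * Real.sqrt (Wpa (u t)) ≤ |Jst (u t)|)) → False) :
    NearExtremalTransiencePerFlow := by
  refine nearExtremalTransiencePerFlow_of_sparseEfficientTimes fun C ν T u p hV => ?_
  by_contra hno
  refine h C ν T u p hV fun N₀ Θ => ?_
  by_contra hcrowd
  apply hno
  refine ⟨N₀, Θ, fun ε hε t₁ ht₁ => ?_⟩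
  by_contra hnone
  apply hcrowd
  refine ⟨ε, hε, t₁, ht₁, fun t ht hgood => hnone ⟨t, ht, hgood⟩⟩

end Summit.NavierStokesRegularity.NavierStokesRegularity.Theorems.NearExtremalTransiencePerFlow.SparseBangBang

end
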